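import Mathlib
import Summits.Ventures.Crystal3D.Theorems.StickyWulffConstantTextureBuildTentCover
import Summits.Ventures.Crystal3D.Theorems.StickyWulffConstantTextureBuildTentCoverLevel
import Summits.Ventures.Crystal3D.Theorems.StickyWulffConstantTextureBuildTentCoverPlane
import Summits.Ventures.Crystal3D.Theorems.StickyWulffConstantTextureBuildTentCoverHeights
import Summits.Ventures.Crystal3D.Theorems.StickyWulffConstantTextureLiminfBarlowFreeCertificate
import HarnessLib

/-!
# Brick (T0): `BarlowFreeCertificateCover` HOLDS — the Barlow tent at ONE COMMON LEVEL; `stub_T0cover` closed by name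

HONEST FRAMING. Venture `Summits/Ventures/Crystal3D` (cell `crystal3d-full`), route `route-Ventures-StickyWulffConstant`,
lane T of the law-v5 crux `TextureLiminfV5` (stmt-Ventures-23912), registered skeleton `HOME/cf-p1/route/lines/tex/TexShadow.lean`
(v8.17+).  Proves, sorry-free with standard axioms, the registered stub `stub_T0cover : BarlowFreeCertificateCover` BY NAME
(`…TextureBuildTentCover.lean`, finding F9: the free certificate WITH the `LayerPlaneCover` clause) — the single named
input of `tb_energy_of_T0` (`…TextureBuildRiserPackage.lean`), i.e. of the derived `stub_TB_energy`.
PROOF.  As in `stub_barlowFreeCertificate` (`…BarlowFreeCertificate.lean`), with the slab certificates LEVEL-PARAMETRISED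
(`tent_bilayer_certificate_level`): the costs of the finitely many occupied bilayers are summed, the null set
`⋃_i {F_i = ⊤}` and the COUNTABLE set of levels at which some layer-plane level set has a unit prism of positive volume
(`Measure.countable_meas_level_set_pos₀` for `g m` = tent of bilayer `m` at the projection along `L e₃` onto plane `m`)
are discarded, and ONE `t` with `Σ_i F_i(t) ≤ Σ_i C_i` is chosen.  COVER: a point `y` of a layer-plane facet of a piece of
slab `i` has `f_i(y) ≥ t` (closure); consecutive bilayer tents AGREE on the shared plane (`tent_pullback_eq_of_shared_layer`,
`height_motion_eq`); so either the relevant `f_m(y) = t` (null prism) or, by DENSITY (`exists_mem_closure_piece`), `y` lies in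
the closure of a piece of the neighbouring slab — excluded by the clause's set difference.
WHAT THIS IS NOT: `stub_TB_cover` (the Mesh₇ cover construction) or any wall stub; F-C1 not moved.
-/

noncomputable section

open scoped BigOperators InnerProductSpace ENNReal
open MeasureTheory Filter

namespace Summit.Ventures.Crystal3D.Cruxes.TextureLiminf.TexShadow

open Summit.Ventures.Crystal3D Summit.Ventures.Crystal3D.TentCertificate Literature.Analysis.Convexity
open Literature.Geometry.DiscreteGeometry (intVec)
open Literature.MathematicalPhysics.StatisticalMechanics (fccStacking barlowStacking IsHaggSeq
  fieldDivergence HasFinitePerimeter fccWulffBody)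

/-- **Brick (T0): the Barlow-free tent certificate WITH the layer-plane cover clause holds** (every Hägg word, frame,
table of bilayer frames, finite atom set, open set): the Barlow tent assembled at ONE COMMON generic level. -/
theorem barlowFreeCertificateCover_holds : BarlowFreeCertificateCover := by
  intro σ hσ L s A hA X hXS U hU
  classical
  -- Step 1: bilayer motions and level-parametrised cubic certificates
  choose T c sw hbil hsurj hslab hht hwulff using fun i : ℤ => exists_bilayerMotion hσ L s i
  have hht' : ∀ (i : ℤ) (a : Site), (lay a = 0 ∨ lay a = 1) →
      height L s (T i (site a) + c i) = layerHeight i (sw i) (lay a) := fun i a h => hht i a h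
  choose F C hFm hC0 hC4 hFint hlev using
    fun i : ℤ => tent_bilayer_certificate_level (pullback (T i) (c i) X) ((fun x => T i x + c i) ⁻¹' U)
  -- Step 2: the finitely many occupied bilayers
  set I : Finset ℤ := (X.image fun x => ⌊height L s x / hB⌋) ∪ (X.image fun x => ⌊height L s x / hB⌋ - 1)
    with hI
  have hI_of_mem : ∀ (i : ℤ) (a : Site), a ∈ pullback (T i) (c i) X → i ∈ I := by
    intro i a ha
    obtain ⟨x, hx, h | h⟩ := exists_floor_of_pullback_nonempty (hht' i) ha
    · exact Finset.mem_union_left _ (Finset.mem_image.2 ⟨x, hx, h.symm⟩)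
    · exact Finset.mem_union_right _ (Finset.mem_image.2 ⟨x, hx, h.symm⟩)
  have hempty : ∀ i, i ∉ I → pullback (T i) (c i) X = ∅ := fun i hi =>
    Finset.eq_empty_of_forall_notMem fun a ha => hi (hI_of_mem i a ha)
  -- Step 3: ONE LEVEL.  (a) the cover-bad levels: positive-volume level prisms of the layer-plane tents
  set ν : E3 := L (EuclideanSpace.single 2 1) with hν
  set g : ℤ → E3 → ℝ := fun m x => if height L s x - m * hB ∈ Set.Icc (0 : ℝ) 1 then
      tent (pullback (T m) (c m) X) ((T m).symm (x - (height L s x - m * hB) • ν - c m)) else 2 with hg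
  have hgm : ∀ m, Measurable (g m) := by
    intro m
    refine Measurable.ite ?_ ?_ measurable_const
    · exact measurableSet_Icc.preimage (((continuous_height L s).sub continuous_const).measurable)
    · refine ((continuous_tent _).comp ((T m).symm.continuous.comp ?_)).measurable
      exact ((continuous_id.sub (((continuous_height L s).sub continuous_const).smul continuous_const)).sub
        continuous_const)
  set BadC : Set ℝ := ⋃ m : ℤ, {t | 0 < volume {x | g m x = t}} with hBadC
  have hBadCc : BadC.Countable :=
    Set.countable_iUnion fun m => Measure.countable_meas_level_set_pos₀ (hgm m).aemeasurable.nullMeasurable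
  set BadF : Set ℝ := ⋃ i : ℤ, {t | F i t = ⊤} with hBadF
  have hBadFm : MeasurableSet BadF := MeasurableSet.iUnion fun i => hFm i (measurableSet_singleton ⊤)
  have hae : ∀ᵐ t ∂(volume.restrict (Set.Ioo (0 : ℝ) 1)), t ∉ BadC ∪ BadF := by
    have h1 : ∀ᵐ t ∂(volume.restrict (Set.Ioo (0 : ℝ) 1)), t ∉ BadC := hBadCc.ae_notMem _
    have h2 : ∀ i : ℤ, ∀ᵐ t ∂(volume.restrict (Set.Ioo (0 : ℝ) 1)), F i t < ⊤ := fun i =>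
      ae_lt_top (hFm i) (ne_top_of_le_ne_top ENNReal.ofReal_ne_top (hFint i))
    rw [← ae_all_iff] at h2
    filter_upwards [h1, h2] with t ht1 ht2
    rintro (h | h)
    · exact ht1 h
    · obtain ⟨i, hi⟩ := Set.mem_iUnion.1 h
      exact (ht2 i).ne hi
  let Ftot : ℝ → ℝ≥0∞ := fun t => if t ∈ BadC ∪ BadF then ⊤ else ∑ i ∈ I, F i t
  have hFtot_m : Measurable Ftot :=
    Measurable.ite (hBadCc.measurableSet.union hBadFm) measurable_const (Finset.measurable_sum _ fun i _ => hFm i)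
  have hFtot_ae : Ftot =ᵐ[volume.restrict (Set.Ioo (0 : ℝ) 1)] fun t => ∑ i ∈ I, F i t := by
    filter_upwards [hae] with t ht
    simp only [Ftot, ht, if_false]
  have hint : ∫⁻ t in Set.Ioo (0 : ℝ) 1, Ftot t ≤ ENNReal.ofReal (∑ i ∈ I, C i) * ENNReal.ofReal (1 - 0) := by
    rw [lintegral_congr_ae hFtot_ae, sub_zero, ENNReal.ofReal_one, mul_one, lintegral_finsetSum _ fun i _ => hFm i,
      ENNReal.ofReal_sum_of_nonneg fun i _ => hC0 i]
    exact Finset.sum_le_sum fun i _ => hFint i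
  obtain ⟨t, ht, hFt⟩ := exists_mem_Ioo_le_of_lintegral_le (P := Ftot) zero_lt_one ENNReal.ofReal_ne_top
    hFtot_m.aemeasurable hint
  have htBad : t ∉ BadC ∪ BadF := fun hmem =>
    ENNReal.ofReal_ne_top (top_le_iff.1 (by simpa only [Ftot, hmem, if_true] using hFt))
  have hFt' : ∑ i ∈ I, F i t ≤ ENNReal.ofReal (∑ i ∈ I, C i) := by simpa only [Ftot, htBad, if_false] using hFt
  have hFi : ∀ i, F i t ≠ ⊤ := fun i hi => htBad (Or.inr (Set.mem_iUnion.2 ⟨i, hi⟩))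
  have hnullC : ∀ m, volume {x | g m x = t} = 0 := fun m => by_contra fun hne =>
    htBad (Or.inl (Set.mem_iUnion.2 ⟨m, pos_iff_ne_zero.2 hne⟩))
  -- Step 4: the pieces of EVERY bilayer at the common level
  choose J Hd hbd h1 hd hdj hsl hfp hsup hexh hball hmass hdiv using fun i : ℤ => hlev i t ht (hFi i)
  have hpiece_mem : ∀ (i : ℤ) (j : Fin (J i)) (x : E3), x ∈ polytope (Hd i j) → i ∈ I := by
    intro i j x hx
    obtain ⟨a, ha, -⟩ := Set.mem_iUnion₂.1 (hball i (Set.mem_iUnion.2 ⟨j, hx⟩))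
    exact hI_of_mem i a ha
  have hslab0 : ∀ (i : ℤ) (j : Fin (J i)), polytope (Hd i j) ⊆ cubicSlab 0 :=
    fun i j x hx => (mem_cubicSlab_zero x).2 (hsl i j hx)
  have hmoved_slab : ∀ (i : ℤ) (j : Fin (J i)),
      (fun x => T i x + c i) '' polytope (Hd i j) ⊆ laySlab L s i := by
    intro i j; rw [← hslab i]; exact Set.image_mono (hslab0 i j)
  -- Step 5: the family of moved pieces of the occupied bilayers
  let K := Σ i : I, Fin (J i)
  let Hd' : K → Finset (E3 × ℝ) := fun k => moveH (T k.1) (c k.1) (Hd k.1 k.2)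
  have hHd' : ∀ k : K, polytope (Hd' k) = (fun x => T k.1 x + c k.1) '' polytope (Hd k.1 k.2) :=
    fun k => (image_polytope_motion _ _ _).symm
  let e := Fintype.equivFin K
  let H : Fin (Fintype.card K) → Finset (E3 × ℝ) := fun j => Hd' (e.symm j)
  set G : Set E3 := ⋃ j, polytope (H j) with hG
  have hGK : G = ⋃ k : K, polytope (Hd' k) := e.symm.surjective.iUnion_comp fun k => polytope (Hd' k)
  have hdisjK : ∀ k k' : K, k ≠ k' → Disjoint (polytope (Hd' k)) (polytope (Hd' k')) := by
    rintro ⟨⟨i, hi⟩, j⟩ ⟨⟨i', hi'⟩, j'⟩ hne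
    rw [hHd', hHd']
    by_cases hii : i = i'
    · subst hii
      have hjj : j ≠ j' := fun h => hne (by subst h; rfl)
      exact (Set.disjoint_image_iff (injective_motion (T i) (c i))).2 (hdj i j j' hjj)
    · exact (disjoint_laySlab L s hii).mono (hmoved_slab i j) (hmoved_slab i' j')
  have hGslab : ∀ i : ℤ, i ∈ I →
      G ∩ laySlab L s i = (fun x => T i x + c i) '' ⋃ j, polytope (Hd i j) := by
    intro i hi
    apply Set.Subset.antisymm
    · rintro y ⟨hyG, hyi⟩
      rw [hGK] at hyG
      obtain ⟨⟨⟨i', hi'⟩, j⟩, hy⟩ := Set.mem_iUnion.1 hyG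
      rw [hHd'] at hy
      have hii : i' = i := by
        by_contra hne
        exact Set.disjoint_left.1 (disjoint_laySlab L s hne) (hmoved_slab i' j hy) hyi
      subst hii
      rw [Set.image_iUnion]; exact Set.mem_iUnion.2 ⟨j, hy⟩
    · rintro y hy
      rw [Set.image_iUnion] at hy
      obtain ⟨j, hj⟩ := Set.mem_iUnion.1 hy
      refine ⟨?_, hmoved_slab i j hj⟩
      rw [hGK]
      exact Set.mem_iUnion.2 ⟨⟨⟨i, hi⟩, j⟩, by rw [hHd']; exact hj⟩
  have hGslab' : ∀ i : ℤ, i ∉ I → G ∩ laySlab L s i = ∅ := by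
    intro i hi
    ext y
    simp only [Set.mem_inter_iff, Set.mem_empty_iff_false, iff_false, not_and]
    intro hyG hyi
    rw [hGK] at hyG
    obtain ⟨⟨⟨i', hi'⟩, j⟩, hy⟩ := Set.mem_iUnion.1 hyG
    rw [hHd'] at hy
    have hii : i' = i := by
      by_contra hne
      exact Set.disjoint_left.1 (disjoint_laySlab L s hne) (hmoved_slab i' j hy) hyi
    subst hii; exact hi hi'
  have cbdd : ∀ j, Bornology.IsBounded (polytope (H j)) := fun j => isBounded_polytope_moveH (hbd _ _)
  have cunit : ∀ j, ∀ p ∈ H j, ‖p.1‖ = 1 := fun j => norm_moveH (h1 _ _)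
  have cdist : ∀ j, ∀ p ∈ H j, ∀ p' ∈ H j, p ≠ p' →
      {x : E3 | ⟪p.1, x⟫_ℝ = p.2} ≠ {x | ⟪p'.1, x⟫_ℝ = p'.2} := fun j => plane_ne_moveH (hd _ _)
  have cdisj : ∀ j j', j ≠ j' → Disjoint (polytope (H j)) (polytope (H j')) :=
    fun j j' hjj => hdisjK _ _ fun h => hjj (e.symm.injective h)
  have cfin : HasFinitePerimeter G :=
    hasFinitePerimeter_iUnion_of_pairwise_disjoint
      (fun j => hasFinitePerimeter_polytope (H j) (cbdd j) (cunit j) (cdist j)) fun j j' hjj => cdisj j j' hjj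
  have cvol : volume G < ⊤ :=
    (measure_iUnion_fintype_le volume _).trans_lt (ENNReal.sum_lt_top.2 fun j _ => (cbdd j).measure_lt_top)
  have hW : ∀ i, wulffOf (A i) = T i '' fccWulffBody := fun i => by obtain ⟨u, hu⟩ := hA i; exact hwulff i (A i) u hu
  -- Step 6: LAYER BOOKKEEPING for the cover clause
  have hΦψ : ∀ (i : ℤ) (y : E3), T i ((T i).symm (y - c i)) + c i = y := fun i y => by simp
  -- the cubic layer `ℓ` of motion `i` at height `m h` goes INTO the stacking layer of height `m h` …
  have hS_in : ∀ (i ℓ m : ℤ), layerHeight i (sw i) ℓ = m * hB → (ℓ = 0 ∨ ℓ = 1) → ∀ a : Site, lay a = ℓ →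
      T i (site a) + c i ∈ {y : E3 | y ∈ stacking L s σ ∧ height L s y = m * hB} := by
    intro i ℓ m hℓ hℓ01 a ha
    have ha01 : lay a = 0 ∨ lay a = 1 := by rw [ha]; exact hℓ01
    exact ⟨bilayer_subset_stacking L s σ i (hbil i a ha01), by rw [hht' i a ha01, ha, hℓ]⟩
  -- … and ONTO it when `m ∈ {i, i+1}`
  have hS_out : ∀ (i ℓ m : ℤ), layerHeight i (sw i) ℓ = m * hB → (m = i ∨ m = i + 1) →
      ∀ y ∈ {y : E3 | y ∈ stacking L s σ ∧ height L s y = m * hB}, ∃ a : Site, lay a = ℓ ∧ T i (site a) + c i = y := by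
    rintro i ℓ m hℓ hm y ⟨⟨r, hr, rfl⟩, hyh⟩
    rw [height_move] at hyh
    have hbil' : L r + s ∈ bilayer L s σ i := by
      refine ⟨r, ⟨hr, ?_⟩, rfl⟩
      rcases hm with rfl | rfl
      · exact Or.inl hyh
      · right; rw [hyh]; push_cast; ring
    obtain ⟨a, ha01, hay⟩ := hsurj i _ hbil'
    refine ⟨a, layerHeight_injective i (sw i) ?_, hay⟩
    rw [← hht' i a ha01, hay, height_move, hyh, hℓ]
  -- AGREEMENT of consecutive bilayer tents on the shared plane `i + 1`
  have hagree : ∀ (i : ℤ) (y : E3), height L s y = ((i : ℝ) + 1) * hB →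
      tent (pullback (T i) (c i) X) ((T i).symm (y - c i)) =
        tent (pullback (T (i + 1)) (c (i + 1)) X) ((T (i + 1)).symm (y - c (i + 1))) := by
    intro i y hy
    obtain ⟨ℓ, hℓ01, hℓ⟩ := exists_cubicLayer i (sw i) (m := i + 1) (Or.inr rfl)
    obtain ⟨ℓ', hℓ'01, hℓ'⟩ := exists_cubicLayer (i + 1) (sw (i + 1)) (m := i + 1) (Or.inl rfl)
    have hy' : height L s y = ((i + 1 : ℤ) : ℝ) * hB := by push_cast; exact hy
    exact tent_pullback_eq_of_shared_layer hℓ01 hℓ'01 X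
      {y : E3 | y ∈ stacking L s σ ∧ height L s y = ((i + 1 : ℤ) : ℝ) * hB}
      (hS_out i ℓ (i + 1) hℓ (Or.inr rfl)) (hS_in (i + 1) ℓ' (i + 1) hℓ' hℓ'01)
      (inner_symm_eq_of_height_eq (hht' (i + 1)) hy' hℓ')
  -- DENSITY: a point of a boundary plane of slab `i` strictly above the level lies in the closure of a piece of slab `i`
  have hdense : ∀ (i m : ℤ) (y : E3), (m = i ∨ m = i + 1) → height L s y = m * hB →
      t < tent (pullback (T i) (c i) X) ((T i).symm (y - c i)) →
      ∃ j, (T i).symm (y - c i) ∈ closure (polytope (Hd i j)) := by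
    intro i m y hm hy hty
    obtain ⟨ℓ, hℓ01, hℓ⟩ := exists_cubicLayer i (sw i) hm
    exact exists_mem_closure_piece (hexh i)
      (mem_closure_slab_of_inner_eq hℓ01 (inner_symm_eq_of_height_eq (hht' i) hy hℓ)) hty
  have hcl_mem : ∀ (i : ℤ) (j : Fin (J i)) (z : E3), z ∈ closure (polytope (Hd i j)) → i ∈ I := by
    intro i j z hz
    by_contra hi
    rw [Set.eq_empty_of_forall_notMem fun x hx => hi (hpiece_mem i j x hx), closure_empty] at hz
    exact hz
  have hcl_Φ : ∀ (i : ℤ) (P : Set E3) (z : E3), z ∈ closure P →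
      T i z + c i ∈ closure ((fun x => T i x + c i) '' P) :=
    fun i P z hz => image_closure_subset_closure_image (isometry_motion (T i) (c i)).continuous ⟨z, hz, rfl⟩
  have hcl_ψ : ∀ (i : ℤ) (P : Set E3) (y : E3), y ∈ closure ((fun x => T i x + c i) '' P) →
      (T i).symm (y - c i) ∈ closure P := by
    intro i P y hy
    have hcont : Continuous fun y : E3 => (T i).symm (y - c i) := (T i).symm.continuous.comp (continuous_id.sub continuous_const)
    have h := image_closure_subset_closure_image hcont ⟨y, hy, rfl⟩
    have hPP : (fun y : E3 => (T i).symm (y - c i)) '' ((fun x => T i x + c i) '' P) = P := by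
      rw [Set.image_image]; simp
    rwa [hPP] at h
  have hge : ∀ (i : ℤ) (j : Fin (J i)) (z : E3), z ∈ closure (polytope (Hd i j)) →
      t ≤ tent (pullback (T i) (c i) X) z := by
    intro i j z hz
    have hsub : polytope (Hd i j) ⊆ {x | t ≤ tent (pullback (T i) (c i) X) x} := fun x hx =>
      show t ≤ _ from le_of_lt (hsup i (Set.mem_iUnion.2 ⟨j, hx⟩))
    exact closure_minimal hsub (isClosed_le continuous_const (continuous_tent _)) hz
  have hgval : ∀ (m : ℤ) (y : E3) (τ : ℝ), height L s y = m * hB → τ ∈ Set.Icc (0 : ℝ) 1 →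
      g m (y + τ • ν) = tent (pullback (T m) (c m) X) ((T m).symm (y - c m)) := by
    intro m y τ hm hτ
    have hτ' : height L s (y + τ • ν) - m * hB = τ := by rw [hν, height_add_smul, hm]; ring
    simp only [hg, hτ', hτ, if_true, add_sub_cancel_right]
  refine ⟨G, cfin, cvol, ?_, ⟨Fintype.card K, H, fun j => (e.symm j).1.1, cbdd, cunit, cdist, cdisj, ?_, rfl, ?_⟩, ?_, ?_⟩
  · -- within `√2` of the atoms
    intro y hy
    rw [hGK] at hy
    obtain ⟨⟨⟨i, hi⟩, j⟩, hy⟩ := Set.mem_iUnion.1 hy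
    rw [hHd'] at hy
    obtain ⟨x, hx, rfl⟩ := hy
    obtain ⟨a, ha, hxa⟩ := Set.mem_iUnion₂.1 (hball i (Set.mem_iUnion.2 ⟨j, hx⟩))
    refine Set.mem_iUnion₂.2 ⟨T i (site a) + c i, (mem_pullback.1 ha).2, ?_⟩
    rw [Metric.mem_closedBall] at hxa ⊢
    rwa [dist_add_right, LinearIsometryEquiv.dist_map]
  · -- every piece lies in its open layer slab
    intro j
    show polytope (Hd' (e.symm j)) ⊆ _
    rw [hHd']; exact hmoved_slab _ _
  · -- THE LAYER-PLANE COVER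
    intro j
    obtain ⟨k, rfl⟩ : ∃ k, j = e k := ⟨e.symm j, (e.apply_symm_apply j).symm⟩
    obtain ⟨⟨i, hi⟩, jj⟩ := k
    have hHk : ∀ (i' : ℤ) (hi' : i' ∈ I) (jj' : Fin (J i')),
        polytope (H (e ⟨⟨i', hi'⟩, jj'⟩)) = (fun x => T i' x + c i') '' polytope (Hd i' jj') := by
      intro i' hi' jj'; show polytope (Hd' (e.symm (e _))) = _; rw [Equiv.symm_apply_apply]; exact hHd' _
    simp only [Equiv.symm_apply_apply]
    show facetArea ((closure (polytope (H (e ⟨⟨i, hi⟩, jj⟩))) ∩ (layerPlane L s i ∪ layerPlane L s (i + 1))) \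
      ⋃ j' : {j' // j' ≠ e ⟨⟨i, hi⟩, jj⟩}, closure (polytope (H j'))) ν = 0
    unfold facetArea
    rw [measure_mono_null _ (measure_union_null (hnullC i) (hnullC (i + 1))), ENNReal.toReal_zero]
    rintro x ⟨y, ⟨⟨hycl, hypl⟩, hynot⟩, τ, hτ, rfl⟩
    have hz : (T i).symm (y - c i) ∈ closure (polytope (Hd i jj)) := hcl_ψ i _ y (by rw [← hHk i hi jj]; exact hycl)
    have hty : t ≤ tent (pullback (T i) (c i) X) ((T i).symm (y - c i)) := hge i jj _ hz
    have hexcl : ∀ (i' : ℤ) (hi' : i' ∈ I) (jj' : Fin (J i')), i' ≠ i →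
        y ∉ closure (polytope (H (e ⟨⟨i', hi'⟩, jj'⟩))) := by
      intro i' hi' jj' hne hmem
      apply hynot
      refine Set.mem_iUnion.2 ⟨⟨e ⟨⟨i', hi'⟩, jj'⟩, fun heq => hne ?_⟩, hmem⟩
      have h := e.injective heq
      exact congrArg (fun q : K => ((q.1 : I) : ℤ)) h
    have hnbr : ∀ (i' : ℤ), i' ≠ i → ∀ m : ℤ, (m = i' ∨ m = i' + 1) → height L s y = m * hB →
        ¬ t < tent (pullback (T i') (c i') X) ((T i').symm (y - c i')) := by
      intro i' hne m hm hy hlt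
      obtain ⟨jj', hjj'⟩ := hdense i' m y hm hy hlt
      have hi' : i' ∈ I := hcl_mem i' jj' _ hjj'
      apply hexcl i' hi' jj' hne
      rw [hHk i' hi' jj']
      have h := hcl_Φ i' _ _ hjj'
      rwa [hΦψ] at h
    rcases hypl with hypl | hypl
    · -- the bottom plane `i`: the other side is slab `i - 1`
      rw [mem_layerPlane_iff] at hypl
      left
      show g i (y + τ • ν) = t
      rw [hgval i y τ hypl hτ]
      rcases hty.eq_or_lt with h | h
      · exact h.symm
      · exfalso
        have hagr := hagree (i - 1) y (by rw [hypl]; push_cast; ring)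
        rw [sub_add_cancel] at hagr
        refine hnbr (i - 1) (by omega) i (Or.inr (sub_add_cancel i 1).symm) hypl ?_
        rw [hagr]; exact h
    · -- the top plane `i + 1`: the other side is slab `i + 1`
      rw [mem_layerPlane_iff] at hypl
      push_cast at hypl
      right
      show g (i + 1) (y + τ • ν) = t
      rw [hgval (i + 1) y τ (by push_cast; exact hypl) hτ]
      rcases hty.eq_or_lt with h | h
      · rw [← hagree i y hypl]; exact h.symm
      · exfalso
        refine hnbr (i + 1) (by omega) (i + 1) (Or.inl rfl) (by push_cast; exact hypl) ?_
        rw [← hagree i y hypl]; exact h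
  · -- mass: off the null layer planes a surrounded point of slab `i` pulls back to a surrounded cubic point
    have hnull : volume ((⋃ k : ℤ, {y : E3 | height L s y = k * hB}) ∪
        ⋃ i : ℤ, (fun x => T i x + c i) ''
          ({y : E3 | (0 < ⟪Literature.Geometry.DiscreteGeometry.intVec (normal4 0), Real.sqrt 2 • y⟫_ℝ ∧
              ⟪Literature.Geometry.DiscreteGeometry.intVec (normal4 0), Real.sqrt 2 • y⟫_ℝ < 2) ∧
              ∀ a : Site, (lay a = 0 ∨ lay a = 1) → dist y (site a) ≤ Real.sqrt 2 → a ∈ pullback (T i) (c i) X} \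
            ⋃ j, polytope (Hd i j))) = 0 := by
      refine measure_union_null (volume_iUnion_planes L s) ((measure_iUnion_null_iff).2 fun i => ?_)
      exact volume_image_motion_null (T i) (c i) (hmass i)
    refine measure_mono_null ?_ hnull
    rintro y ⟨hyM, hyG⟩
    by_cases hpl : ∃ k : ℤ, height L s y = k * hB
    · obtain ⟨k, hk⟩ := hpl; exact Or.inl (Set.mem_iUnion.2 ⟨k, hk⟩)
    push Not at hpl
    have hyi : y ∈ laySlab L s ⌊height L s y / hB⌋ := mem_laySlab_floor L s hpl
    generalize hi : ⌊height L s y / hB⌋ = i at hyi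
    rw [← hslab i] at hyi
    obtain ⟨x, hx0, hxy⟩ := hyi
    refine Or.inr (Set.mem_iUnion.2 ⟨i, x, ⟨⟨(mem_cubicSlab_zero x).1 hx0, fun a ha hda => ?_⟩,
      fun hxP => hyG ?_⟩, hxy⟩)
    · refine mem_pullback.2 ⟨ha, hyM _ (bilayer_subset_stacking L s σ i (hbil i a ha)) ?_⟩
      rw [← hxy, dist_add_right, LinearIsometryEquiv.dist_map]; exact hda
    · obtain ⟨j, hj⟩ := Set.mem_iUnion.1 hxP
      have hiI : i ∈ I := hpiece_mem i j x hj
      rw [hGK]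
      exact Set.mem_iUnion.2 ⟨⟨⟨i, hiI⟩, j⟩, by rw [hHd']; exact ⟨x, hj, hxy⟩⟩
  · -- the slab-wise Wulff perimeters at the common level
    have hper : ∀ i : ℤ, perKIn (wulffOf (A i)) G (U ∩ laySlab L s i) ≤ if i ∈ I then F i t else 0 := by
      intro i
      rw [perKIn_eq_anisotropicPerimeterIn, anisotropicPerimeterIn_inter_of_subset _ _
        (isOpen_laySlab L s i).measurableSet Set.inter_subset_right]
      by_cases hi : i ∈ I
      · rw [if_pos hi, hGslab i hi, hW i]
        have hUV : U ∩ laySlab L s i =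
            (fun x => T i x + c i) '' (((fun x => T i x + c i) ⁻¹' U) ∩ cubicSlab 0) := by
          rw [Set.image_preimage_inter, hslab i]
        rw [hUV, anisotropicPerimeterIn_rigidMotion]
        refine anisotropicPerimeterIn_le_iff.2 fun ξ hξ1 hξ2 hξ3 hξ4 => ENNReal.ofReal_le_of_le_toReal ?_
        exact hdiv i ξ hξ1 hξ2 hξ3
          (hξ4.trans (Set.inter_subset_inter_right _ fun x hx => (mem_cubicSlab_zero x).1 hx))
      · rw [if_neg hi, hGslab' i hi, anisotropicPerimeterIn_empty]
    have hC_zero : ∀ i, i ∉ I → C i = 0 := by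
      intro i hi
      have h4 := hC4 i
      rw [brokenNearIP_eq_empty_of_pullback (hempty i hi), brokenNearIL_eq_empty_of_pullback (hempty i hi),
        Set.ncard_empty] at h4
      simp only [Nat.cast_zero, mul_zero, add_zero] at h4
      linarith [hC0 i]
    have hBBfin := stackingBonds_finite hσ X hXS U
    have hcount := sum_ncard_le_two_mul_ncard hBBfin (height L s) hB_pos.ne' I
      (fun i => bondMap (T i) (c i) '' brokenNearIP (pullback (T i) (c i) X) ((fun x => T i x + c i) ⁻¹' U))
      (fun i => bondMap (T i) (c i) '' brokenNearIL (pullback (T i) (c i) X) ((fun x => T i x + c i) ⁻¹' U))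
      (fun i _ => bondMap_brokenNearIP_subset (hbil i) (hht' i))
      (fun i _ => bondMap_brokenNearIL_subset (hbil i) (hht' i))
    simp only [ncard_image_bondMap] at hcount
    have hreal : 2 * ∑ i ∈ I, C i ≤ ((stackingBonds (stacking L s σ) X U).ncard : ℝ) := by
      have hsum : 4 * ∑ i ∈ I, C i ≤ ∑ i ∈ I,
          (((brokenNearIP (pullback (T i) (c i) X) ((fun x => T i x + c i) ⁻¹' U)).ncard : ℝ) +
            2 * ((brokenNearIL (pullback (T i) (c i) X) ((fun x => T i x + c i) ⁻¹' U)).ncard : ℝ)) := by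
        rw [Finset.mul_sum]; exact Finset.sum_le_sum fun i _ => hC4 i
      have hcast : (∑ i ∈ I,
          (((brokenNearIP (pullback (T i) (c i) X) ((fun x => T i x + c i) ⁻¹' U)).ncard : ℝ) +
            2 * ((brokenNearIL (pullback (T i) (c i) X) ((fun x => T i x + c i) ⁻¹' U)).ncard : ℝ))) ≤
          2 * ((stackingBonds (stacking L s σ) X U).ncard : ℝ) := by exact_mod_cast hcount
      linarith
    calc 2 * ∑' i, perKIn (wulffOf (A i)) G (U ∩ laySlab L s i)
        ≤ 2 * ∑' i : ℤ, (if i ∈ I then F i t else 0) :=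
          mul_le_mul_right (ENNReal.tsum_le_tsum hper) 2
      _ = 2 * ∑ i ∈ I, F i t := by
          rw [tsum_eq_sum (s := I) fun i hi => if_neg hi]
          congr 1
          exact Finset.sum_congr rfl fun i hi => if_pos hi
      _ ≤ 2 * ENNReal.ofReal (∑ i ∈ I, C i) := mul_le_mul_right hFt' 2
      _ = ENNReal.ofReal (2 * ∑ i ∈ I, C i) := by
          rw [ENNReal.ofReal_mul zero_le_two, ENNReal.ofReal_ofNat]
      _ ≤ ENNReal.ofReal ((stackingBonds (stacking L s σ) X U).ncard : ℝ) := ENNReal.ofReal_le_ofReal hreal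
      _ = (brokenNearIn (stacking L s σ) X U : ℝ≥0∞) := by rw [brokenNearIn_eq, ENNReal.ofReal_natCast]

/-- **The registered stub `stub_T0cover` of the lane-T skeleton `TexShadow` (v8.17+), CLOSED BY NAME.** -/
theorem stub_T0cover : BarlowFreeCertificateCover := barlowFreeCertificateCover_holds

end Summit.Ventures.Crystal3D.Cruxes.TextureLiminf.TexShadow

end
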